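import Mathlib
import Summits.ResolutionOfSingularities.ResolutionOfSingularities.Theses.WeightedInvariant
import Literature.AlgebraicGeometry.Resolution.ResolutionOfComponents

/-!
# Sketch — crux-ideate stmt-ResolutionOfSingularities-0569 (`WeightedInvariant.WeightedThesis`), ideator 1, round 1

First lemmas of the two idea cards (they must elaborate; the small ones are proved):

* §Kunz  (card `kunz-tower-exceptional-defect`): `KunzCriterion` (named-fact shape, Kunz 1969 Thm 2.1) and
  `residue_image_frobClosure` — the residue-level half of the EXCEPTIONAL DEFECT LEMMA (proved).
* §Kirwan (card `wild-kirwan-augmentation`): `augIdeal`, its `G`-stability `smul_mem_augIdeal` (proved),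
  and `KiralyLutkebohmert` (named-fact shape, Király–Lütkebohmert, ANT 7 (2013) 63–74, Thm 2 (a)⇒(c)⇒(d)).
* §Twist: `hasResolution_transport` — `HasResolution` is a property of the abstract scheme (used by both
  lines through the Frobenius twist `X ≅ X^{(p)}` over a perfect field); here from the tree lemma
  `Scheme.HasResolution.of_iso`.
-/

namespace Summit.ResolutionOfSingularities.ResolutionOfSingularities.Cruxes.WeightedThesis.Ideator1

open IsLocalRing

section Kunz

/-- NAMED-FACT SHAPE (Kunz 1969, Amer. J. Math. 91, Thm. 2.1): a Noetherian local ring of prime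
characteristic `p` is regular iff its Frobenius endomorphism is flat (flat local homomorphisms are
faithfully flat hence injective, so flatness already forces reducedness).  Not in Mathlib; the line uses
it as the STABILISATION ⇒ REGULAR step: if the normalised F-blowup `FB₁(Y)^ν → Y` is an isomorphism then
`F_* 𝒪_Y` is flat, hence `Y` is regular (Yasuda arXiv:0706.2700 Prop. 2.7). -/
def KunzCriterion : Prop :=
  ∀ (p : ℕ) [Fact p.Prime] (R : Type) [CommRing R] [IsLocalRing R] [IsNoetherianRing R] [CharP R p],
    (frobenius R p).Flat ↔ IsRegularLocalRing R

/-- EXCEPTIONAL DEFECT LEMMA, residue-level half (proved, pure algebra).  In the first normalised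
F-blowup `π : Y → X` the flattened Frobenius algebra is the subsheaf of rings `𝒪_X[𝒪_Y^p] ⊆ 𝒪_Y`; at a
point `ξ ∈ Y` over `x ∈ X` its stalk is the subring of `A = 𝒪_{Y,ξ}` generated by the `p`-th powers of
`A` and the image `C` of `𝒪_{X,x}`.  IF that subring is all of `A` (i.e. the flattened algebra is normal
at `ξ`, equivalently Frobenius of `Y` is already flat at `ξ`) THEN the residue field `κ(ξ)` is generated
by `p`-th powers and residues of `C`, i.e. `κ(ξ) = κ(ξ)^p · κ(x)`; for the finitely generated extension
`κ(ξ)/κ(x)` this forces SEPARABLE ALGEBRAIC — false at the generic point of every `π`-exceptional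
divisor.  Hence ONE flattening never flattens Frobenius of the new model, and the defect
`𝒪_Y / 𝒪_X[𝒪_Y^p]` is supported exactly on the exceptional locus: the quantity the ITERATED tower must
kill. [folklore; `𝒪_X[𝒪_Y^p]` = structure sheaf of the dominant component of `Hilb_{p^d}(X₁/X)` pulled
back to `Y`, Yasuda arXiv:0706.2700 §2.1] -/
theorem residue_image_frobClosure {A : Type*} [CommRing A] [IsLocalRing A] (p : ℕ)
    (C : Subring A)
    (h : Subring.closure (Set.range (fun a : A => a ^ p) ∪ (C : Set A)) = ⊤) :
    Subring.closure (Set.range (fun x : ResidueField A => x ^ p) ∪ (residue A '' (C : Set A))) = ⊤ := by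
  apply top_unique
  intro x _
  obtain ⟨a, rfl⟩ := IsLocalRing.residue_surjective x
  have ha : a ∈ Subring.closure (Set.range (fun a : A => a ^ p) ∪ (C : Set A)) := by
    rw [h]; trivial
  have hmap : (Subring.closure (Set.range (fun a : A => a ^ p) ∪ (C : Set A))).map (residue A) ≤
      Subring.closure (Set.range (fun x : ResidueField A => x ^ p) ∪ (residue A '' (C : Set A))) := by
    rw [RingHom.map_closure]
    apply Subring.closure_mono
    rintro y ⟨b, hb, rfl⟩
    rcases hb with ⟨c, rfl⟩ | hb
    · exact Or.inl ⟨residue A c, by simp⟩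
    · exact Or.inr ⟨b, hb, rfl⟩
  exact hmap ⟨a, ha, rfl⟩

end Kunz

section Kirwan

variable (B : Type*) [CommRing B] (G : Type*) [Group G] [MulSemiringAction G B]

/-- The AUGMENTATION IDEAL `I_G = (g • b - b : g ∈ G, b ∈ B)` of Király–Lütkebohmert (for `G` cyclic of
prime order it is generated by the `σ b - b` of one generator `σ`); its zero scheme is the fixed-point
scheme of the action. [cite: arXiv:1001.1945 = doi:10.2140/ant.2013.7.63, §1] -/
def augIdeal : Ideal B := Ideal.span {x : B | ∃ (g : G) (b : B), x = g • b - b}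

/-- The augmentation ideal is `G`-stable — so are its divisorial part and the residual locus `V(J)`
that the line blows up; for `σ` central in a bigger group the same identity
`g(hb - b) = (ghg⁻¹)(gb) - gb` gives stability under the bigger group. [folklore] -/
theorem smul_mem_augIdeal (g : G) {x : B} (hx : x ∈ augIdeal B G) : g • x ∈ augIdeal B G := by
  unfold augIdeal at *
  induction hx using Submodule.span_induction with
  | mem y hy =>
    obtain ⟨h, b, rfl⟩ := hy
    have : g • (h • b - b) = (g * h * g⁻¹) • (g • b) - (g • b) := by
      simp [smul_sub, mul_smul]
    rw [this]
    exact Ideal.subset_span ⟨g * h * g⁻¹, g • b, rfl⟩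
  | zero => simp
  | add y z _ _ hy hz => simpa [smul_add] using Ideal.add_mem _ hy hz
  | smul a y _ hy =>
    simpa [smul_eq_mul, MulSemiringAction.smul_mul] using Ideal.mul_mem_left _ (g • a) hy

/-- NAMED-FACT SHAPE (Király–Lütkebohmert 2013, Thm. 2, implications (a) ⇒ (b) ⇒ (c) ⇒ (d)): for a
`p`-cyclic group `G` of LOCAL automorphisms of a regular local ring `B`, if the augmentation ideal is
principal then `B` is free over the ring of invariants `A = B^G` and `A` is REGULAR.  This is the first
terminal-form criterion of the wild-Kirwan line (principal augmentation ideal at a point of an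
equivariant regular model ⇒ regular quotient there).  To be vendored as a Literature fact; stated over
Mathlib's `FixedPoints.subring`. [cite: doi:10.2140/ant.2013.7.63, Thm. 2] -/
def KiralyLutkebohmert : Prop :=
  ∀ (p : ℕ) [Fact p.Prime] (B : Type) [CommRing B] [IsRegularLocalRing B] (G : Type) [Group G]
    [Fintype G] [MulSemiringAction G B] [FaithfulSMul G B],
    Fintype.card G = p → (∀ g : G, ∀ b : B, b ∈ maximalIdeal B → g • b ∈ maximalIdeal B) →
    (augIdeal B G).IsPrincipal →
      IsRegularLocalRing (FixedPoints.subring B G) ∧ Module.Free (FixedPoints.subring B G) B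

end Kirwan

section Twist

/-- Bookkeeping used by BOTH lines and specific to PERFECT ground fields: `HasResolution` is a property
of the abstract scheme, hence invariant under the Frobenius twist `X^{(p)} ≅ X` (an isomorphism of
schemes, not of `k`-schemes, available exactly because `k` is perfect).  In the tree this is
`Scheme.HasResolution.of_iso`; restated in the transport form the assemblies quote. [folklore] -/
theorem hasResolution_transport {X Z : AlgebraicGeometry.Scheme.{0}} (g : X ⟶ Z)
    [CategoryTheory.IsIso g] (h : Literature.AlgebraicGeometry.Resolution.Scheme.HasResolution X) :
    Literature.AlgebraicGeometry.Resolution.Scheme.HasResolution Z :=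
  Literature.AlgebraicGeometry.Resolution.Scheme.HasResolution.of_iso g h

end Twist

end Summit.ResolutionOfSingularities.ResolutionOfSingularities.Cruxes.WeightedThesis.Ideator1
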